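import Summits.FinalStateConjecture.FinalStateConjecture.Theorems.EIHFluxBalanceInertialRecessionStubRechart11Region
import Summits.FinalStateConjecture.FinalStateConjecture.Theorems.EIHFluxBalanceInertialRecessionStubRechart11Orient
import Summits.FinalStateConjecture.FinalStateConjecture.Theorems.EIHFluxBalanceInertialRecessionRechartOfut
import Summits.FinalStateConjecture.FinalStateConjecture.Statement

/-!
# Stub `stub_noHolesOnRegion` of line `SketchCleanExcision`
# (crux `InertialRecession` (E′), `stmt-FinalStateConjecture-17403`, route `EIHFluxBalance`)

**The dispersive case `N = 0` of the restated crux, ON THE GIVEN REGION `O`.** With no hole the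
modulated Kerr–Schild ansatz is the Minkowski background on `U`, and the lab chart `Φ` itself is
the flat (radiation-zone) chart of a decomposition with no hole chart, started one unit of lab
time later (`d.τ₀ := τ₀ + 1`, flat domain `U`). On the hypothesis' own region
`O = J⁺(ι X) ∩ I⁻(Φ{x⁰ > τ₀})`:

* `O = exteriorOf 𝒟 d.charted`, `d.charted = Φ{x⁰ > τ₀ + 1}`: `⊇` by monotonicity of `I⁻`;
  `⊆` because the exhaustion clause of the hypothesis puts every point of `O` in
  `Φ{x⁰ > τ₁} ∪ J⁻(Φ{x⁰ = τ₁})` (`τ₁ > τ₀`), and `J⁻(W) = I⁻(W)` for the OPEN set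
  `W = Φ{x⁰ > τ₀ + 1}` (`causalPast_subset_chronologicalPast_of_isOpen`, push-up);
* `HasExhaustiveCharts d` (honest radii vacuous over `Fin 0`) is the exhaustion clause at chart
  times `τ₁ > τ₀ + 1`;
* `IsFutureOriented d`: clauses (i), (ii) are vacuous; (iii) — eventually `dΦ(e₀)` is
  future-directed on the flat slabs — from `C⁰` closeness (`η(e₀, e₀) = −1`, so `dΦ(e₀)` is
  eventually timelike; `eventually_isFutureDirected_flatChart`) and the SIGN from hypothesis (T),
  eventual lab-time causality: a past-directed timelike `dΦ_x w` with `w⁰ > 0` at a late `x`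
  would give a future timelike receding segment `σ ↦ Φ(x − s(σ) w)` ending in `J⁺(Φ x)` at a
  smaller lab time (`isFutureDirected_mfderiv_of_labTimeCausality`, …RechartOfut).

All of this is the `N = 0` instance of the landed assembly theorem
`exists_finalStateDecomposition_onRegion_of_rechart` (…StubRechart11Region; no hole charts, flat
domain `U₀ = U`, transfer = the exhaustion clause), whose flat-chart inputs are manufactured as in
the landed `inertialRecession_noHoles` (…NoHoles: `deviationCk_mk_congr` replaces the empty
Kerr–Schild sum by `η`, `deviationCk_mono` lowers `C³` to `C²`, the open embedding is restricted to
the smaller late region). Maximality and admissibility are not used.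
[O'Neill 1983, Ch. 5 p. 145, Ch. 14 pp. 402–404; folklore]
-/

noncomputable section

set_option linter.dupNamespace false

namespace Summit.FinalStateConjecture.FinalStateConjecture.Theorems

open scoped BigOperators Topology Manifold Classical MeasureTheory Matrix InnerProductSpace ContDiff ENNReal
open Filter Set Function TopologicalSpace MeasureTheory Literature.Geometry.Lorentzian

namespace SketchCleanExcision

section Flat

variable {X : Type} [TopologicalSpace X] [ChartedSpace E3 X] [IsManifold (𝓡 3) ∞ X]
  [ConnectedSpace X] {D : InitialDataSet (𝓡 3) X}

/-- **The flat lab chart is eventually future-oriented, from eventual lab-time causality.** If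
`Φ : U → M` is smooth, `{T < x⁰} ⊆ U`, lab time is causal on `{T < x⁰}`
(`Φ y ∈ J⁺(Φ x) ⇒ x⁰ ≤ y⁰`) and `Φ^* g → η` in `Cᵏ` on the flat slabs of `U`, then eventually in
`τ`, at every point of the flat slab `{x⁰ = τ} ∩ U`, `dΦ(e₀)` is future-directed causal: it is
eventually timelike by `C⁰` closeness, and not past-directed by lab-time causality
(`isFutureDirected_mfderiv_of_labTimeCausality`). Clause (iii) of `IsFutureOriented` for the
flat chart `Φ ∘ Opens.inclusion le_rfl = Φ`. [folklore] -/
theorem eventually_isFutureDirected_flatChart_of_labTimeCausality (𝒟 : VacuumCauchyDevelopment D)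
    (U : Opens E4) (Φ : U → 𝒟.carrier) (hΦ : ContMDiff 𝓘(ℝ, E4) (𝓡 4) ∞ Φ) {T : ℝ}
    (hTU : {z : E4 | T < z 0} ⊆ (U : Set E4))
    (hT : ∀ x y : U, T < x.1 0 → T < y.1 0 →
      Φ y ∈ 𝒟.metric.causalFuture 𝒟.timeOrientation {Φ x} → x.1 0 ≤ y.1 0)
    {k : ℕ} (hdev : Tendsto (fun t ↦ 𝒟.toSpacetime.deviationCk (Minkowski.backgroundOn U)
      (Φ ∘ Opens.inclusion le_rfl) k t) atTop (𝓝 0)) :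
    ∀ᶠ τ in atTop, ∀ x ∈ (Minkowski.backgroundOn U).timeSlab τ,
      𝒟.timeOrientation.IsFutureDirected
        (mfderiv 𝓘(ℝ, E4) (𝓡 4) (Φ ∘ Opens.inclusion le_rfl) x (E4.basisVector 0)) := by
  have hS : IsOpen {z : E4 | T < z 0} :=
    isOpen_lt continuous_const (PiLp.continuous_apply 2 _ 0)
  have hT' : ∀ x y : U, x.1 ∈ {z : E4 | T < z 0} → y.1 ∈ {z : E4 | T < z 0} →
      Φ y ∈ 𝒟.metric.causalFuture 𝒟.timeOrientation {Φ x} → x.1 0 ≤ y.1 0 :=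
    fun x y hx hy h ↦ hT x y hx hy h
  exact eventually_isFutureDirected_flatChart U Φ (fun x ↦ T < x.1 0) hΦ
    (fun x hx w hw htl ↦ isFutureDirected_mfderiv_of_labTimeCausality hΦ hS hTU hT' x hx hw htl)
    U le_rfl (TQ := T) (fun x hx ↦ hx) hdev

end Flat

/-- **Stub `stub_noHolesOnRegion` (N0 · the dispersive case on the given region).** Under the
twelve-clause antecedent block of the restated crux `InertialRecession` (E′) with `N = 0` and
(T) eventual lab-time causality, the hypothesis' own region `O` carries a `C²` final-state
decomposition `d` with no hole (`d.τ₀ = τ₀ + 1`, flat domain `U`, flat chart `Φ`), sub-extremal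
(vacuously), `O = exteriorOf 𝒟 d.charted`, `HasExhaustiveCharts d` and `IsFutureOriented d`. The
`N = 0` instance of `exists_finalStateDecomposition_onRegion_of_rechart` with the flat-chart inputs
of `inertialRecession_noHoles` and the orientation clause
`eventually_isFutureDirected_flatChart_of_labTimeCausality`; see the module docstring.
[O'Neill 1983, Ch. 14, pp. 402–404; folklore] -/
theorem stub_noHolesOnRegion : ∀ (X : Type) [TopologicalSpace X] [ChartedSpace E3 X] [IsManifold (𝓡 3) ((⊤ : ℕ∞) : WithTop ℕ∞) X] [T2Space X] [SecondCountableTopology X] [ConnectedSpace X], ∀ D ∈ admissibleVacuumData X, ∀ 𝒟 : VacuumCauchyDevelopment D, 𝒟.IsMaximal → ∀ (N : ℕ) (M a rin : Fin N → ℝ) (Λ : Fin N → ℝ → lorentzGroup) (ξ : Fin N → ℝ → E3) (γ κ τ₀ : ℝ) (U : Opens E4) (Φ : U → 𝒟.carrier) (O : Set 𝒟.carrier), ((∀ i, Kerr.IsSubextremal (M i) (a i) ∧ Kerr.rMinus (M i) (a i) < rin i ∧ rin i < Kerr.rPlus (M i) (a i)) ∧ (∀ i t, |((Λ i t : E4 ≃L[ℝ]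 E4) (E4.basisVector 0)) 0| ≤ γ) ∧ (∀ i, ContDiff ℝ ((⊤ : ℕ∞) : WithTop ℕ∞) (ξ i) ∧ ContDiff ℝ ((⊤ : ℕ∞) : WithTop ℕ∞) (fun t ↦ ((Λ i t : E4 ≃L[ℝ] E4) : E4 →L[ℝ] E4))) ∧ (∀ i j, i ≠ j → Tendsto (fun t ↦ ‖ξ i t - ξ j t‖) atTop atTop) ∧ (0 < κ ∧ κ < 1 ∧ ∀ i, ∀ᶠ t in atTop, ‖ξ i t‖ ≤ κ ^ 2 * t) ∧ ({x : E4 | τ₀ < x 0 ∧ ∀ i, rin i < Kerr.radius (a i) (poincareInv (Λ i (x 0)) (E4.ofTimeSpace (x 0) (ξ i (x 0))) x)} ⊆ (U : Set E4)) ∧ let B : ModelBackground := ⟨U, fun x ↦ Minkowski.bilin + ∑ i, (boostedKerrBilin (Λ i (x 0)) (E4.ofTimeSpace (x 0) (ξ i (x 0))) (M i) (a i) x - Minkowski.bilin), fun x ↦ x 0, E4.spatialNorm⟩; ContMDiff 𝓘(ℝ, E4) (𝓡 4) ((⊤ : ℕ∞) : WithTop ℕ∞) Φ ∧ Topology.IsOpenEmbedding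 ((B.lateRegion τ₀).restrict Φ) ∧ Φ '' {x : U | τ₀ < x.1 0 ∧ ∀ i, Kerr.rPlus (M i) (a i) < Kerr.radius (a i) (poincareInv (Λ i (x.1 0)) (E4.ofTimeSpace (x.1 0) (ξ i (x.1 0))) x.1)} ⊆ O ∧ Tendsto (fun t ↦ 𝒟.toSpacetime.deviationCk B Φ 3 t) atTop (𝓝 0) ∧ Tendsto (fun t : ℝ ↦ ⨆ x ∈ {x : U | x.1 0 = t ∧ E4.spatialNorm x.1 ≤ κ * t}, ⨆ (m : ℕ) (_ : m ≤ 3), ENNReal.ofReal (1 + √(√((⨅ i, ‖E4.spatial x.1 - ξ i t‖) ^ 7))) * ‖iteratedFDeriv ℝ m (𝒟.toSpacetime.deviationExtend B Φ) x.1‖ₑ) atTop (𝓝 0) ∧ O = Summit.FinalStateConjecture.exteriorOf 𝒟.toCauchyDevelopment (Φ '' {x : U | τ₀ < x.1 0 ∧ ∀ i, Kerr.rPlus (M i) (a i) < Kerr.radius (a i) (poincareInv (Λ i (x.1 0)) (E4.ofTimeSpace (x.1 0) (ξ i (x.1 0))) x.1)}) ∧ ∀ t₁ : ℝ, τ₀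 < t₁ → O \ Φ '' {x : U | t₁ < x.1 0 ∧ ∀ i, Kerr.rPlus (M i) (a i) < Kerr.radius (a i) (poincareInv (Λ i (x.1 0)) (E4.ofTimeSpace (x.1 0) (ξ i (x.1 0))) x.1)} ⊆ 𝒟.metric.causalPast 𝒟.timeOrientation (Φ '' {x : U | x.1 0 = t₁ ∧ ∀ i, Kerr.rPlus (M i) (a i) < Kerr.radius (a i) (poincareInv (Λ i (x.1 0)) (E4.ofTimeSpace (x.1 0) (ξ i (x.1 0))) x.1)})) → N = 0 → (∃ τ₁ : ℝ, ∀ x y : U, (τ₁ < x.1 0 ∧ ∀ i, rin i < Kerr.radius (a i) (poincareInv (Λ i (x.1 0)) (E4.ofTimeSpace (x.1 0) (ξ i (x.1 0))) x.1)) → (τ₁ < y.1 0 ∧ ∀ i, rin i < Kerr.radius (a i) (poincareInv (Λ i (y.1 0)) (E4.ofTimeSpace (y.1 0) (ξ i (y.1 0))) y.1)) → Φ y ∈ 𝒟.metric.causalFuture 𝒟.timeOrientation {Φ x} → x.1 0 ≤ y.1 0) →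
    ∃ d : FinalStateDecomposition 𝒟.toSpacetime O 2, (∀ i, Kerr.IsSubextremal (d.mass i) (d.spin i)) ∧ O = Summit.FinalStateConjecture.exteriorOf 𝒟.toCauchyDevelopment d.charted ∧ Summit.FinalStateConjecture.HasExhaustiveCharts d ∧ Summit.FinalStateConjecture.IsFutureOriented d := by
  intro X _ _ _ _ _ _ D _ 𝒟 _ N M a rin Λ ξ γ κ τ₀ U Φ O hL hN hT
  subst hN
  obtain ⟨-, -, -, -, -, hU, hB⟩ := hL
  obtain ⟨hΦ, hemb, himO, hdev, -, hO, hexh⟩ := hB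
  obtain ⟨τ₁, hT⟩ := hT
  simp only [IsEmpty.forall_iff, and_true] at hU hexh hT
  -- the Minkowski background on `U`: the empty Kerr–Schild sum is `η`
  have hb : (fun x : E4 ↦ Minkowski.bilin + ∑ i : Fin 0, (boostedKerrBilin (Λ i (x 0))
      (E4.ofTimeSpace (x 0) (ξ i (x 0))) (M i) (a i) x - Minkowski.bilin)) =
      fun _ ↦ Minkowski.bilin := by
    funext x
    rw [Fin.sum_univ_zero]
    abel
  have hdev' : Tendsto (fun t ↦ 𝒟.toSpacetime.deviationCk (Minkowski.backgroundOn U) Φ 3 t)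
      atTop (𝓝 0) :=
    hdev.congr fun t ↦ deviationCk_mk_congr _ U hb _ _ Φ 3 t
  have hdev2 : Tendsto (fun t ↦ 𝒟.toSpacetime.deviationCk (Minkowski.backgroundOn U)
      (Φ ∘ Opens.inclusion le_rfl) 2 t) atTop (𝓝 0) :=
    tendsto_of_tendsto_of_tendsto_of_le_of_le tendsto_const_nhds hdev' (fun _ ↦ zero_le)
      fun t ↦ 𝒟.toSpacetime.deviationCk_mono (Minkowski.backgroundOn U) Φ (by norm_num) t
  -- the late regions `{x⁰ > τ₀}` ⊇ `{x⁰ > τ₀ + 1}` of the flat background on `U`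
  have hsub : (Minkowski.backgroundOn U).lateRegion (τ₀ + 1) ⊆
      (Minkowski.backgroundOn U).lateRegion τ₀ :=
    (Minkowski.backgroundOn U).lateRegion_mono (by linarith)
  -- open embedding on the smaller late region
  have hemb' : Topology.IsOpenEmbedding
      (((Minkowski.backgroundOn U).lateRegion (τ₀ + 1)).restrict (Φ ∘ Opens.inclusion le_rfl)) := by
    have hc0 : Continuous fun y : E4 ↦ y 0 := PiLp.continuous_apply 2 _ 0
    have hL0 : IsOpen ((Minkowski.backgroundOn U).lateRegion τ₀) :=
      isOpen_lt continuous_const (hc0.comp continuous_subtype_val)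
    have hL1 : IsOpen ((Minkowski.backgroundOn U).lateRegion (τ₀ + 1)) :=
      isOpen_lt continuous_const (hc0.comp continuous_subtype_val)
    let j : (Minkowski.backgroundOn U).lateRegion (τ₀ + 1) →
        (Minkowski.backgroundOn U).lateRegion τ₀ := fun x ↦ ⟨x.1, hsub x.2⟩
    have hg0 : Topology.IsOpenEmbedding
        (fun x : (Minkowski.backgroundOn U).lateRegion τ₀ ↦ (x.1.1 : E4)) :=
      U.isOpen.isOpenEmbedding_subtypeVal.comp hL0.isOpenEmbedding_subtypeVal
    have hg1 : Topology.IsOpenEmbedding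
        (fun x : (Minkowski.backgroundOn U).lateRegion (τ₀ + 1) ↦ (x.1.1 : E4)) :=
      U.isOpen.isOpenEmbedding_subtypeVal.comp hL1.isOpenEmbedding_subtypeVal
    have hj : Topology.IsOpenEmbedding j := Topology.IsOpenEmbedding.of_comp j hg0 hg1
    exact hemb.comp hj
  -- the late half-space `{x⁰ > max τ₀ τ₁}` lies in `U` and lab time is causal on it (T)
  have hTU : {z : E4 | max τ₀ τ₁ < z 0} ⊆ (U : Set E4) := fun z hz ↦
    hU (show τ₀ < z 0 from (le_max_left _ _).trans_lt hz)
  have hT' : ∀ x y : U, max τ₀ τ₁ < x.1 0 → max τ₀ τ₁ < y.1 0 →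
      Φ y ∈ 𝒟.metric.causalFuture 𝒟.timeOrientation {Φ x} → x.1 0 ≤ y.1 0 :=
    fun x y hx hy h ↦ hT x y ((le_max_right _ _).trans_lt hx) ((le_max_right _ _).trans_lt hy) h
  -- orientation clause (iii) of the flat chart
  have hflatO := eventually_isFutureDirected_flatChart_of_labTimeCausality 𝒟 U Φ hΦ hTU hT' hdev2
  -- assembly on the given region: no hole chart, flat domain `U`, transfer = exhaustion clause
  refine exists_finalStateDecomposition_onRegion_of_rechart 𝒟 M a (fun i ↦ i.elim0)
    (fun i ↦ i.elim0) U Φ hΦ O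
    (fun x ↦ ∀ i : Fin 0, Kerr.rPlus (M i) (a i) < Kerr.radius (a i)
      (poincareInv (Λ i (x.1 0)) (E4.ofTimeSpace (x.1 0) (ξ i (x.1 0))) x.1))
    (show τ₀ < τ₀ + 1 from lt_add_one τ₀) hO himO (fun i ↦ i.elim0) (fun i ↦ i.elim0)
    (fun i ↦ i.elim0) (fun i ↦ i.elim0) (fun i ↦ i.elim0) (fun i ↦ i.elim0) (fun i ↦ i.elim0)
    (fun i ↦ i.elim0) (fun i ↦ i.elim0) (fun _ ↦ ⟨0, fun i ↦ i.elim0⟩) (fun i ↦ i.elim0)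
    (fun i ↦ i.elim0) U le_rfl (fun i ↦ i.elim0) (fun i ↦ i.elim0) ?_ hdev2 hemb'
    (fun _ _ i ↦ i.elim0) hflatO ?_
  · -- the flat domain contains the late half-space `{x⁰ > τ₀ + 1}`
    intro x hx
    exact hU (show τ₀ < x 0 from lt_trans (lt_add_one τ₀) hx.1)
  · -- the transfer at chart time `t₁ ≥ τ₀ + 1` is the exhaustion clause of the hypothesis
    intro t₁ ht₁ p hp
    by_cases hpl : p ∈ Φ '' {x : U | t₁ < x.1 0}
    · exact Or.inl (Or.inl hpl)
    · have hJ := hexh t₁ (lt_of_lt_of_le (lt_add_one τ₀) ht₁) ⟨hp, hpl⟩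
      exact Or.inr (LorentzianMetric.causalFuture_mono subset_union_left hJ)

/-- Registered one-line form (carrier `eventually_isFutureDirected_flatChart_of_labTime_sce12` of the crux
item `stmt-FinalStateConjecture-17403`, whose registered copy of the signature of `stub_noHolesOnRegion` is cut at
the `let B : ModelBackground :=` of the antecedent block) of
`eventually_isFutureDirected_flatChart_of_labTimeCausality`. [folklore] -/
theorem eventually_isFutureDirected_flatChart_of_labTime_sce12 : open Literature.Geometry.Lorentzian Filter Topology in ∀ {X : Type} [TopologicalSpace X] [ChartedSpace E3 X] [IsManifold (𝓡 3) ((⊤ : ℕ∞) : WithTop ℕ∞) X] [ConnectedSpace X] {D : InitialDataSet (𝓡 3) X} (𝒟 : VacuumCauchyDevelopment D) (U : TopologicalSpace.Opens E4) (Φ : U → 𝒟.carrier), ContMDiff 𝓘(ℝ, E4) (𝓡 4) ((⊤ : ℕ∞) : WithTop ℕ∞) Φ → ∀ {T : ℝ}, {z : E4 | T < z 0} ⊆ (U : Set E4) → (∀ x y : U, T < x.1 0 → T < y.1 0 → Φ y ∈ 𝒟.metric.causalFuture 𝒟.timeOrientation {Φ x} → x.1 0 ≤ y.1 0) → ∀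 {k : ℕ}, Tendsto (fun t ↦ 𝒟.toSpacetime.deviationCk (Minkowski.backgroundOn U) (Φ ∘ TopologicalSpace.Opens.inclusion le_rfl) k t) atTop (𝓝 0) → ∀ᶠ τ in atTop, ∀ x ∈ (Minkowski.backgroundOn U).timeSlab τ, 𝒟.timeOrientation.IsFutureDirected (mfderiv 𝓘(ℝ, E4) (𝓡 4) (Φ ∘ TopologicalSpace.Opens.inclusion le_rfl) x (E4.basisVector 0)) :=
  fun 𝒟 U Φ hΦ _ hTU hT _ hdev ↦
    eventually_isFutureDirected_flatChart_of_labTimeCausality 𝒟 U Φ hΦ hTU hT hdev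

end SketchCleanExcision

end Summit.FinalStateConjecture.FinalStateConjecture.Theorems

end
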